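import Literature.Computability.QuantumComplexity.GaussianRank
import Literature.Computability.QuantumComplexity.DecisionDiagrams
import Literature.Computability.Cryptography.QuantumCircuitProofs
import Summits.QuantumAdvantage.QuantumAdvantage.Theorems.NegApproxGaussRankSuperpoly.Negative.LoadBearing

/-!
# Crux `SpinorFlattening.NegApproxGaussRankSuperpoly` (stmt-QuantumAdvantage-1245) — stub `stub_magicInvariant`

Line `spectral-mass-flattening`, stub `stub_magicInvariant`: the matchgate-magic power
`|M⟩^{⊗t} = magicMPow t` on `t * 4` qubits (block `b` = wires `finProdFinEquiv (b, i) = 4b + i`,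
`i : Fin 4`; amplitude `(√2)^{-t}` on the bit strings constant on every block, `0` elsewhere) is

1. fixed by every block string `X_{4b₀} X_{4b₀+1} X_{4b₀+2} X_{4b₀+3}` — complementing block `b₀`
   preserves block-constancy, and all row phases of `X`/`I` are `1`;
2. fixed by every in-block pair `Z_{4b₀+i₁} Z_{4b₀+i₂}` (`i₁ ≠ i₂`) — no bit is flipped, and on the
   support of `|M⟩^{⊗t}` the two bits agree, so the phase `(−1)^{x(b₀,i₁)} (−1)^{x(b₀,i₂)}` is `1`;
3. a unit vector: `star M^t ⬝ᵥ M^t = normSq M^t = 1` (`normSq_magicMPow`, LoadBearing).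

The computation runs through the closed form of the action of a Pauli string on a state vector,
`(σ_S ψ)(x) = (∏_w rowPhase (S w) (x w)) · ψ (x ⊕ flips S)` (`magicInvariant_pauliString_mulVec_apply`),
obtained from the one-letter table `Pauli.mat_apply_eq_ite` (DecisionDiagrams.lean).
-/

noncomputable section

namespace Summit.QuantumAdvantage.QuantumAdvantage.Theorems.SpinorFlattening

open Matrix Finset
open Literature.Computability.QuantumComplexity Literature.Computability.Cryptography

/-- Entries of a Pauli string: row `x` of `σ_S` has its single nonzero entry
`∏_w rowPhase (S w) (x w)` in the column `x ⊕ flips S` (letterwise `Pauli.mat_apply_eq_ite`). -/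
theorem magicInvariant_pauliString_apply {n : ℕ} (S : Fin n → Pauli) (x y : QReg n) :
    pauliString S x y =
      if ∀ w, y w = Bool.xor (x w) (S w).flipsBit then ∏ w, Pauli.rowPhase (S w) (x w) else 0 := by
  rw [pauliString_eq, tensorAll_apply]
  simp_rw [Pauli.mat_apply_eq_ite]
  rw [Fintype.prod_ite_zero]
  split_ifs <;> rfl

/-- **Action of a Pauli string on a state vector** in closed form:
`(σ_S ψ)(x) = (∏_w rowPhase (S w) (x w)) · ψ (fun w => x w ⊕ flipsBit (S w))`. -/
theorem magicInvariant_pauliString_mulVec_apply {n : ℕ} (S : Fin n → Pauli) (ψ : QReg n → ℂ)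
    (x : QReg n) :
    (pauliString S *ᵥ ψ) x =
      (∏ w, Pauli.rowPhase (S w) (x w)) * ψ (fun w => Bool.xor (x w) (S w).flipsBit) := by
  simp only [Matrix.mulVec, dotProduct, magicInvariant_pauliString_apply]
  rw [Finset.sum_eq_single (fun w => Bool.xor (x w) (S w).flipsBit)]
  · rw [if_pos fun w => rfl]
  · intro y _ hy
    rw [if_neg fun h => hy (funext h), zero_mul]
  · exact fun h => absurd (Finset.mem_univ _) h

/-- The block string `X⊗X⊗X⊗X` on block `b₀` fixes `|M⟩^{⊗t}`: all row phases are `1`, and the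
flipped bit string is `x` complemented on block `b₀`, which is block-constant iff `x` is. -/
theorem magicInvariant_blockX_mulVec (t : ℕ) (b₀ : Fin t) :
    pauliString (fun w : Fin (t * 4) =>
        if (finProdFinEquiv.symm w).1 = b₀ then Pauli.X else Pauli.I) *ᵥ magicMPow t =
      magicMPow t := by
  classical
  funext x
  rw [magicInvariant_pauliString_mulVec_apply]
  have hphase : (∏ w : Fin (t * 4), Pauli.rowPhase
      (if (finProdFinEquiv.symm w).1 = b₀ then Pauli.X else Pauli.I) (x w)) = 1 := by
    refine Finset.prod_eq_one fun w _ => ?_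
    split_ifs <;> simp [Pauli.rowPhase]
  rw [hphase, one_mul]
  by_cases h : ∀ (k : Fin t) (i : Fin 4),
      x (finProdFinEquiv (k, i)) = x (finProdFinEquiv (k, (0 : Fin 4)))
  · rw [magicMPow_apply t x, if_pos h, magicMPow_apply, if_pos]
    intro k i
    simp only [Equiv.symm_apply_apply]
    rw [h k i]
  · rw [magicMPow_apply t x, if_neg h, magicMPow_apply, if_neg]
    intro h'
    apply h
    intro k i
    have hki := h' k i
    simp only [Equiv.symm_apply_apply] at hki
    exact Bool.xor_left_inj.1 hki

/-- Distinct positions in one block are distinct wires. -/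
theorem magicInvariant_wire_ne {t : ℕ} (b₀ : Fin t) {i₁ i₂ : Fin 4} (h : i₁ ≠ i₂) :
    (finProdFinEquiv (b₀, i₁) : Fin (t * 4)) ≠ finProdFinEquiv (b₀, i₂) := fun he =>
  h (Prod.mk.inj (finProdFinEquiv.injective he)).2

/-- The in-block pair `Z_{4b₀+i₁} Z_{4b₀+i₂}` (`i₁ ≠ i₂`) fixes `|M⟩^{⊗t}`: no bit is flipped, and
on the support of `|M⟩^{⊗t}` (block-constant strings) the two `Z` phases coincide and multiply to `1`. -/
theorem magicInvariant_blockZZ_mulVec (t : ℕ) (b₀ : Fin t) (i₁ i₂ : Fin 4) (h12 : i₁ ≠ i₂) :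
    pauliString (fun w : Fin (t * 4) =>
        if w = finProdFinEquiv (b₀, i₁) ∨ w = finProdFinEquiv (b₀, i₂) then Pauli.Z else Pauli.I) *ᵥ
          magicMPow t = magicMPow t := by
  classical
  funext x
  rw [magicInvariant_pauliString_mulVec_apply]
  have hflip : (fun w : Fin (t * 4) => Bool.xor (x w)
      (if w = finProdFinEquiv (b₀, i₁) ∨ w = finProdFinEquiv (b₀, i₂) then Pauli.Z
        else Pauli.I).flipsBit) = x := by
    funext w
    split_ifs <;> simp [Pauli.flipsBit]
  rw [hflip]
  by_cases h : ∀ (k : Fin t) (i : Fin 4),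
      x (finProdFinEquiv (k, i)) = x (finProdFinEquiv (k, (0 : Fin 4)))
  · rw [Fintype.prod_eq_mul (finProdFinEquiv (b₀, i₁)) (finProdFinEquiv (b₀, i₂))
      (magicInvariant_wire_ne b₀ h12)]
    · simp only [true_or, or_true, if_true]
      rw [h b₀ i₁, h b₀ i₂]
      cases x (finProdFinEquiv (b₀, (0 : Fin 4))) <;> simp [Pauli.rowPhase]
    · rintro w ⟨hw₁, hw₂⟩
      rw [if_neg (not_or.2 ⟨hw₁, hw₂⟩)]
      simp [Pauli.rowPhase]
  · rw [magicMPow_apply t x, if_neg h, mul_zero]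

/-- `|M⟩^{⊗t}` is a unit vector for the standard Hermitian form: `star M^t ⬝ᵥ M^t = 1`. -/
theorem magicInvariant_star_dotProduct_self (t : ℕ) : star (magicMPow t) ⬝ᵥ magicMPow t = 1 := by
  rw [← ofReal_normSq_eq_dotProduct,
    Summit.QuantumAdvantage.QuantumAdvantage.Theorems.NegApproxGaussRankSuperpoly.Negative.normSq_magicMPow,
    Complex.ofReal_one]

/-- **stub_magicInvariant** — `|M⟩^{⊗t}` is a unit vector fixed by every block string `X⊗X⊗X⊗X`
(complementing a block preserves block-constancy and the amplitude `(√2)^{-t}`) and by every in-block pair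
`Z_{4b+i₁} Z_{4b+i₂}` (on the support the two bits agree). Closed-form computation on `magicMPow`. -/
theorem stub_magicInvariant : ∀ t : ℕ,
    (∀ b₀ : Fin t, pauliString (fun w : Fin (t * 4) =>
        if (finProdFinEquiv.symm w).1 = b₀ then Pauli.X else Pauli.I) *ᵥ magicMPow t = magicMPow t) ∧
    (∀ (b₀ : Fin t) (i₁ i₂ : Fin 4), i₁ ≠ i₂ → pauliString (fun w : Fin (t * 4) =>
        if w = finProdFinEquiv (b₀, i₁) ∨ w = finProdFinEquiv (b₀, i₂) then Pauli.Z else Pauli.I) *ᵥ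
          magicMPow t = magicMPow t) ∧
    star (magicMPow t) ⬝ᵥ magicMPow t = 1 :=
  fun t => ⟨magicInvariant_blockX_mulVec t, magicInvariant_blockZZ_mulVec t,
    magicInvariant_star_dotProduct_self t⟩

end Summit.QuantumAdvantage.QuantumAdvantage.Theorems.SpinorFlattening

end
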